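import Summits.ValiantsHypothesis.ValiantsHypothesis.Theorems.LacunarySymmetroidMatrixDescartesWLawTwoSignCell

/-!
# `MatrixDescartes` census — the `m = 2` pivot rows hold OFF THE HARD CELL for every `K`: `Z₊ ≤ 2K` unless `det J < 0`
# and EVERY letter pairs negatively with the pivot

HONEST FRAMING.  Cell `pub-symmetroid`, seat `val-sym-mdr-p2` (gen 9); helper file `--supports` the crux
`Theses.LacunarySymmetroid.MatrixDescartes` (stmt-ValiantsHypothesis-18050, OPEN, on HOLD), NO closure claim.  A partial UPPER row in conjb-1's
pivot currency at `m = 2`, ALL `K`: the `K`-general form of this lineage's g6 sign-cell law (`WLawTwoSignCell.wLawTwo_posRoots_le_six_of_offCell`,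
`K = 3`), packaged from the tree's general engine `WLawTwoSignCell.pivotTwo_posRoots_le_signCell` (a negative coefficient of `det` sits at `2e` only
when `det J < 0`, at `e + dₖ` only when letter `k` pairs negatively with the pivot) and Mathlib's Descartes count
(`Pivot.TwoDescartes.card_posRoots_le_two_mul_card`).

RESULT.  For a `2 × 2` pivot pencil `X^e J + ∑ₖ X^{dₖ} Pₖ` with `K` PSD letters, `J` ANY real matrix (no index hypothesis), and no letter at the
pivot exponent: if `det J ≥ 0`, or if SOME letter has pairing `J₀₀(Pₖ)₁₁ + J₁₁(Pₖ)₀₀ − (J₀₁+J₁₀)(Pₖ)₀₁ ≥ 0`, then `Z₊ ≤ 2K`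
(`pivotTwo_posRoots_le_two_mul_of_offCell`) — the budget `2(m−1)(K−1) + 2 = 2K` of the typed bilinear guess `RankOnePivotLawBilinear` at `m = 2`.
So the open content of the `m = 2` rows `PivotRootLawAt 2 K q (2K)` (`K ≥ 4`; `K ≤ 3` proved, `…CensusPivotTwoSmallRows`, `…PivotTwoThree`)
is the HARD CELL: `det J < 0` and all `K` pairings negative (the tree's `2K + 2`, `Pivot.TwoDescartes.pivotTwo_posRoots_le`, is the Descartes
count there).  Located/paper note (this seat's memo PIVOT-COLUMNS-K2K5K6.md §2): in the hard cell the tropical limit of the scalar envelope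
(`…CensusPivotTwoEnvelope`) has at most `K` valleys, hence `≤ 2K` crossings tropically; the non-tropical statement is open.
Nothing here bears on `MatrixDescartes` in its window, on `DoorA26` / `DoorA34`, registers / credences, or `VP ≠ VNP`.

[folklore] Descartes' rule of signs with a support count; no definitions, no named facts.
-/

set_option linter.dupNamespace false

namespace Summit.ValiantsHypothesis.ValiantsHypothesis.Theorems.LacunarySymmetroidMatrixDescartes

open Polynomial Finset
open scoped BigOperators

/-- **`m = 2` pivot pencils OFF THE HARD CELL have `Z₊ ≤ 2K`** (any `K`, any real `J`, PSD letters, no letter at the pivot exponent):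
if `det J ≥ 0` or some letter pairs non-negatively with the pivot, `det (X^e J + ∑ₖ X^{dₖ} Pₖ)` has at most `2K` distinct positive zeros.
[folklore] -/
theorem pivotTwo_posRoots_le_two_mul_of_offCell {K : ℕ} (e : ℕ) (d : Fin K → ℕ) (J : Matrix (Fin 2) (Fin 2) ℝ)
    (P : Fin K → Matrix (Fin 2) (Fin 2) ℝ) (hP : ∀ k, (P k).PosSemidef) (hd : ∀ k, d k ≠ e)
    (hcell : 0 ≤ J.det ∨ ∃ k, 0 ≤ J 0 0 * P k 1 1 + J 1 1 * P k 0 0 - (J 0 1 + J 1 0) * P k 0 1) :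
    ((Matrix.det (((X : ℝ[X]) ^ e) • J.map Polynomial.C
        + ∑ k, ((X : ℝ[X]) ^ d k) • (P k).map Polynomial.C)).roots.toFinset.filter (fun t => 0 < t)).card
      ≤ 2 * K := by
  classical
  rcases hcell with hJ | ⟨k₀, hk₀⟩
  · -- `det J ≥ 0`: the negative coefficients sit among the `K` degrees `e + dₖ`
    have h := WLawTwoSignCell.pivotTwo_posRoots_le_signCell e d J P hP hd
      (Finset.univ.image fun k => e + d k) (fun hlt => absurd hlt (not_lt.mpr hJ))
      (fun k _ => Finset.mem_image.mpr ⟨k, Finset.mem_univ _, rfl⟩)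
    refine h.trans ?_
    have hc : (Finset.univ.image fun k => e + d k).card ≤ K := by
      simpa using (Finset.card_image_le (s := (Finset.univ : Finset (Fin K))) (f := fun k => e + d k))
    omega
  · -- letter `k₀` pairs non-negatively: the negative coefficients sit among `2e` and the `K − 1` other `e + dₖ`
    have h := WLawTwoSignCell.pivotTwo_posRoots_le_signCell e d J P hP hd
      (insert (e + e) ((Finset.univ.erase k₀).image fun k => e + d k)) (fun _ => Finset.mem_insert_self _ _)
      (fun k hk => by
        refine Finset.mem_insert_of_mem (Finset.mem_image.mpr ⟨k, ?_, rfl⟩)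
        refine Finset.mem_erase.mpr ⟨?_, Finset.mem_univ _⟩
        rintro rfl
        exact absurd hk (not_lt.mpr hk₀))
    refine h.trans ?_
    have h1 : ((Finset.univ.erase k₀).image fun k => e + d k).card ≤ K - 1 := by
      refine (Finset.card_image_le).trans ?_
      rw [Finset.card_erase_of_mem (Finset.mem_univ _), Finset.card_univ, Fintype.card_fin]
    have h2 := Finset.card_insert_le (e + e) ((Finset.univ.erase k₀).image fun k => e + d k)
    have hK : 1 ≤ K := Nat.succ_le_of_lt (Fin.pos k₀)
    omega

/-- Row form in the census currency: for `2 × 2` pivot pencils off the hard cell (and with no letter at the pivot exponent)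
`pivotPosRoots e d J P ≤ 2K` — uniformly in the index of `J`. [bookkeeping] -/
theorem Pivot.pivotPosRoots_two_le_of_offCell {K : ℕ} (e : ℕ) (d : Fin K → ℕ) (J : Matrix (Fin 2) (Fin 2) ℝ)
    (P : Fin K → Matrix (Fin 2) (Fin 2) ℝ) (hP : ∀ k, (P k).PosSemidef) (hd : ∀ k, d k ≠ e)
    (hcell : 0 ≤ J.det ∨ ∃ k, 0 ≤ J 0 0 * P k 1 1 + J 1 1 * P k 0 0 - (J 0 1 + J 1 0) * P k 0 1) :
    Pivot.pivotPosRoots e d J P ≤ 2 * K := by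
  unfold Pivot.pivotPosRoots
  exact pivotTwo_posRoots_le_two_mul_of_offCell e d J P hP hd hcell

/-- **A letter AT the pivot exponent also gives `Z₊ ≤ 2K`** (any `K`, any real `J`, PSD letters): merge that letter into the pivot and apply
the tree's `2(K−1) + 2` count `Pivot.TwoDescartes.pivotTwo_posRoots_le` to the remaining `K − 1` letters. [folklore] -/
theorem pivotTwo_posRoots_le_two_mul_of_atPivot {K : ℕ} (e : ℕ) (d : Fin K → ℕ) (J : Matrix (Fin 2) (Fin 2) ℝ)
    (P : Fin K → Matrix (Fin 2) (Fin 2) ℝ) (hP : ∀ k, (P k).PosSemidef) (k : Fin K) (hk : d k = e) :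
    ((Matrix.det (((X : ℝ[X]) ^ e) • J.map Polynomial.C
        + ∑ l, ((X : ℝ[X]) ^ d l) • (P l).map Polynomial.C)).roots.toFinset.filter (fun t => 0 < t)).card
      ≤ 2 * K := by
  classical
  cases K with
  | zero => exact k.elim0
  | succ K' =>
    have hsum : ((X : ℝ[X]) ^ e) • J.map Polynomial.C + ∑ l, ((X : ℝ[X]) ^ d l) • (P l).map Polynomial.C
        = ((X : ℝ[X]) ^ e) • (J + P k).map Polynomial.C
          + ∑ j : Fin K', ((X : ℝ[X]) ^ d (k.succAbove j)) • (P (k.succAbove j)).map Polynomial.C := by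
      ext i j
      simp only [Matrix.add_apply, Matrix.smul_apply, Matrix.map_apply, Matrix.sum_apply, Fin.sum_univ_succAbove _ k, hk,
        Polynomial.C_add, smul_eq_mul]
      ring
    rw [hsum]
    have h := Pivot.TwoDescartes.pivotTwo_posRoots_le e (fun j => d (k.succAbove j)) (J + P k)
      (fun j => P (k.succAbove j)) (fun j => hP _)
    simpa [two_mul, add_assoc, add_comm, add_left_comm] using h

/-- **THE `m = 2` ROWS CAN ONLY FAIL IN THE HARD CELL.**  For a `2 × 2` pivot pencil with `K` PSD letters and any real `J`:
if some letter sits at the pivot exponent, or `det J ≥ 0`, or some letter pairs non-negatively with the pivot, then `Z₊ ≤ 2K`.  The complement —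
no letter at the pivot exponent, `det J < 0`, all `K` pairings negative — is the HARD CELL, where the Descartes count is `2K + 2`
(`Pivot.TwoDescartes.pivotTwo_posRoots_le`) and `2K` is open for `K ≥ 4`. [folklore] -/
theorem pivotTwo_posRoots_le_two_mul_unless_hardCell {K : ℕ} (e : ℕ) (d : Fin K → ℕ) (J : Matrix (Fin 2) (Fin 2) ℝ)
    (P : Fin K → Matrix (Fin 2) (Fin 2) ℝ) (hP : ∀ k, (P k).PosSemidef)
    (h : (∃ k, d k = e) ∨ 0 ≤ J.det ∨ ∃ k, 0 ≤ J 0 0 * P k 1 1 + J 1 1 * P k 0 0 - (J 0 1 + J 1 0) * P k 0 1) :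
    ((Matrix.det (((X : ℝ[X]) ^ e) • J.map Polynomial.C
        + ∑ l, ((X : ℝ[X]) ^ d l) • (P l).map Polynomial.C)).roots.toFinset.filter (fun t => 0 < t)).card
      ≤ 2 * K := by
  by_cases hat : ∃ k, d k = e
  · obtain ⟨k, hk⟩ := hat
    exact pivotTwo_posRoots_le_two_mul_of_atPivot e d J P hP k hk
  · have hd : ∀ k, d k ≠ e := fun k hk => hat ⟨k, hk⟩
    rcases h with ⟨k, hk⟩ | hcell
    · exact absurd hk (hd k)
    · exact pivotTwo_posRoots_le_two_mul_of_offCell e d J P hP hd hcell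

/-- Row form: outside the hard cell `pivotPosRoots e d J P ≤ 2K` at `m = 2`, uniformly in the index. [bookkeeping] -/
theorem Pivot.pivotPosRoots_two_le_unless_hardCell {K : ℕ} (e : ℕ) (d : Fin K → ℕ) (J : Matrix (Fin 2) (Fin 2) ℝ)
    (P : Fin K → Matrix (Fin 2) (Fin 2) ℝ) (hP : ∀ k, (P k).PosSemidef)
    (h : (∃ k, d k = e) ∨ 0 ≤ J.det ∨ ∃ k, 0 ≤ J 0 0 * P k 1 1 + J 1 1 * P k 0 0 - (J 0 1 + J 1 0) * P k 0 1) :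
    Pivot.pivotPosRoots e d J P ≤ 2 * K := by
  unfold Pivot.pivotPosRoots
  exact pivotTwo_posRoots_le_two_mul_unless_hardCell e d J P hP h

end Summit.ValiantsHypothesis.ValiantsHypothesis.Theorems.LacunarySymmetroidMatrixDescartes
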